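import Summits.NavierStokesRegularity.FunctionalMining.HsWordEnergies
import HarnessLib

/-!
# FunctionalMining — Gibbon's chessboard on `T³` at EVERY order `n`, squares `1 ≤ m ≤ 3`:
# `∫₀ᵀ ‖∇ⁿu‖_{2m}^{α_{n,m}} dt ≤ K(1+T)`, `α_{n,m} = 2m/(2m(n+1)−3)`

Search for candidate a priori estimates; no regularity claim. Cell `pub-nsfunc`, lit seat (gen 16).
Gibbon (J. Nonlinear Sci. 29 (2019) 215–228, Thm 1 with Table 1, Thm 2 (i) and Appendix A §5.1) rolls
"all the known time-averaged estimates for weak solutions" into the chessboard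
`⟨‖∇ⁿu‖_{2m}^{α_{n,m}}⟩_T < ∞`, `α_{n,m} = 2m/(2m(n+1)−3)`, `n ≥ 1`, `1 ≤ m ≤ ∞`; its column `m = 1`
is Foias–Guillopé–Temam 1981 Thm 3.1, in the tree at every real order
(`HsTimeAverages.timeAverage_le`), and the other squares follow from it by the Sobolev and Agmon
inequalities and Hölder's inequality in time (Appendix A). The tree had the squares reachable from
`H¹, H², H³` (`TorusNSChessboardTimeAverages`, `…HigherSquares`, `TorusNSFoiasGuillopeTemamH3`); THIS
FILE proves, for CLASSICAL zero-mean solutions of the unforced equations on `[0, T] × T³` with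
`‖u(0)‖₂² ≤ M` and EVERY order `n`, the squares `1 < m ≤ 3` (with
`|∇ⁿu(t,x)|² = ∑_{w : Fin n → Fin 3} ‖∂^w u(t,x)‖²`, `‖∇ⁿu‖_{2m}^{α_{n,m}} = (∫|∇ⁿu|^{2m})^{1/(2m(n+1)−3)}`):

* `HsChessboard.continuousOn_integral_wordSq_rpow` — continuity of `t ↦ ∫|∇ⁿu(t)|^{2m}` (tube lemma);
* `HsChessboard.time_holder` — Hölder in time in the printed shape: `∫₀ᵀf ≤ K₁(1+T)`,
  `∫₀ᵀg ≤ K₂(1+T)` ⇒ `∫₀ᵀ f^a g^b ≤ K₁^aK₂^b(1+T)` (`a + b = 1`);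
* `HsChessboard.chessboard_three` — **square `(n, 3)`, every `n ≥ 0`**:
  `∫₀ᵀ (∫|∇ⁿu|⁶)^{1/(6n+3)} ≤ K(1+T)` (Sobolev at order `n`, `HsWordEnergy`, + FGT at `s = n+1`);
* `HsChessboard.integral_wordSq_rpow_le_low`, `HsChessboard.chessboard_low` — **squares `(n, m)`,
  `1 < m < 3`, every `n ≥ 1`**: `∫|∇ⁿv|^{2m} ≤ C^{(m−1)/2} E_n^{(3−m)/2} E_{n+1}^{3(m−1)/2}` (here by
  `L²–L⁶` interpolation; cf. Gibbon App. A §5.1, where the step is Gagliardo–Nirenberg with an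
  auxiliary order `N`, arXiv eqs. (pr2)–(adef2)) and
  `∫₀ᵀ (∫|∇ⁿu|^{2m})^{1/(2m(n+1)−3)} ≤ K(1+T)` (Hölder in time with weights
  `(3−m)(2n−1)/(2(2m(n+1)−3)) + 3(m−1)(2n+1)/(2(2m(n+1)−3)) = 1` against FGT at `s = n, n+1`).

The squares `3 < m ≤ ∞` are in `HsChessboardHigh`. Faithfulness: classical instead of Leray–Hopf
solutions, `f = 0`, bounds `K(1+T)` with `K = K(n, m, ν, ‖u₀‖)` existential instead of
`c_{n,m}L⁻¹ν^{α}Re³ + O(T⁻¹)`. A priori bounds in the energy class; no regularity claim.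

## Mathlib / tree search

Tree (used): `HsWordEnergy.exists_integral_cube_sum_norm_sq_wordDeriv_le`, `….wordEnergy_eq_torusHsEnergy`
(`HsWordEnergies`), `HsTimeAverages.timeAverage_le(_nat)`, `….integral_rpow_mul_rpow_le`,
`….continuousOn_hsEnergy`, `Torus.isSmoothSpaceTimeOn_wordDeriv` (`TorusWordSpaceTime`),
`Torus.integral_rpow_le_interpolate_two_six'` (`TorusNSBeiraoDaVeigaCriterion`),
`Torus.eventually_norm_sub_lt_of_continuousOn` (tube lemma). Pattern of `TorusNSChessboardTimeAverages`
(`Torus.exists_classicalNS_integral_gradSq_rpow_le`, the square `(1, m)`).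

## References

* [Gibbon2019Chessboard] J. D. Gibbon, J. Nonlinear Sci. 29 (2019) 215–228, Thm 1 / Table 1,
  Thm 2 (i) eq. (w1), Appendix A §5.1 (Gagliardo–Nirenberg step, arXiv eqs. (pr2)–(adef2))
  (held: arXiv:1803.11518 pp. 4–7).
* [FoiasGuillopeTemam1981] Comm. PDE 6 (1981) 329–359, Thm 3.1.
-/

noncomputable section

open MeasureTheory Set Filter Topology Function Real intervalIntegral Finset UnitAddTorus
open scoped InnerProductSpace RealInnerProductSpace ENNReal BigOperators

namespace Summit.NavierStokesRegularity.FunctionalMining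

open Literature.Analysis Literature.Analysis.FunctionSpaces Literature.Analysis.FluidPDE
open Literature.Analysis.FunctionSpaces.Torus Literature.Analysis.FluidPDE.Torus

namespace HsChessboard

variable {d : Type*} [Fintype d] [DecidableEq d]

/-! ## 1. Continuity in time of `∫ |∇ⁿu(t)|^{2m} dx` -/

omit [DecidableEq d] in
/-- Space integrals of fields with continuous space–time lift and continuous slices depend
continuously on time (tube lemma over the compact torus). [folklore] -/
private theorem continuousOn_integral_of_continuousOn_stLift {S : Set ℝ}
    {φ : ℝ → UnitAddTorus d → ℝ} (hφ : ContinuousOn (Torus.stLift φ) (S ×ˢ univ))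
    (hsl : ∀ t ∈ S, Continuous (φ t)) : ContinuousOn (fun t => ∫ x, φ t x) S := by
  intro t ht
  rw [ContinuousWithinAt, Metric.tendsto_nhds]
  intro ε hε
  have h := Torus.eventually_norm_sub_lt_of_continuousOn hφ ht (half_pos hε)
  filter_upwards [h, self_mem_nhdsWithin] with s hs hsS
  have his : Integrable (φ s) := (hsl s hsS).integrable_unitAddTorus
  have hit : Integrable (φ t) := (hsl t ht).integrable_unitAddTorus
  rw [Real.dist_eq, ← integral_sub his hit]
  calc |∫ x, (φ s x - φ t x)| ≤ ∫ x, |φ s x - φ t x| := abs_integral_le_integral_abs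
    _ ≤ ∫ _x : UnitAddTorus d, ε / 2 := by
        refine integral_mono_of_nonneg (ae_of_all _ fun x => abs_nonneg _) (integrable_const _)
          (ae_of_all _ fun x => ?_)
        have h1 := hs x
        rw [Real.norm_eq_abs] at h1
        exact h1.le
    _ = ε / 2 := by simp
    _ < ε := half_lt_self hε

/-- Along a classical solution on `[a, b] × T^d`, `t ↦ ∫ |∇ⁿu(t)|^{2m} dx = ∫ (∑_w ‖∂^w u(t)‖²)^m dx`
is continuous on `[a, b]` for every `n` and every real `m ≥ 0`. [folklore] -/
theorem continuousOn_integral_wordSq_rpow {ν a b : ℝ} (hab : a < b)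
    {f u : ℝ → UnitAddTorus d → EuclideanSpace ℝ d} {p : ℝ → UnitAddTorus d → ℝ}
    (h : IsClassicalNSSolutionOn (Icc a b) ν f u p) (n : ℕ) {m : ℝ} (hm : 0 ≤ m) :
    ContinuousOn (fun t => ∫ x, (∑ w : Fin n → d, ‖wordDeriv (List.ofFn w) (u t) x‖ ^ 2) ^ m)
      (Icc a b) := by
  have hU : UniqueDiffOn ℝ (Icc a b) := uniqueDiffOn_Icc hab
  have hst : ∀ w : Fin n → d, ContinuousOn (Torus.stLift fun t => wordDeriv (List.ofFn w) (u t))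
      (Icc a b ×ˢ univ) := fun w =>
    (Torus.isSmoothSpaceTimeOn_wordDeriv h.smooth_velocity hU (List.ofFn w)).continuousOn_stLift
  refine continuousOn_integral_of_continuousOn_stLift ?_ fun t ht => ?_
  · have e : Torus.stLift (fun t x => (∑ w : Fin n → d, ‖wordDeriv (List.ofFn w) (u t) x‖ ^ 2) ^ m) =
        fun q => (∑ w : Fin n → d, ‖Torus.stLift (fun t => wordDeriv (List.ofFn w) (u t)) q‖ ^ 2) ^ m :=
      rfl
    rw [e]
    exact (continuousOn_finsetSum _ fun w _ => ((hst w).norm).pow 2).rpow_const fun q _ => Or.inr hm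
  · have hut : IsSmooth (u t) := h.smooth_velocity.isSmooth_slice ht
    exact (continuous_finsetSum _ fun w _ =>
      ((isSmooth_wordDeriv hut _).continuous.norm).pow 2).rpow_const fun x => Or.inr hm

/-! ## 2. Hölder in time in the shape `K(1+T)` -/

/-- **Hölder in time, printed shape**: if `f, g ≥ 0` are continuous on `[0, T]` with
`∫₀ᵀ f ≤ K₁(1+T)`, `∫₀ᵀ g ≤ K₂(1+T)` and `a + b = 1`, `a, b > 0`, then
`∫₀ᵀ f^a g^b ≤ K₁^a K₂^b (1+T)`. [folklore] -/
theorem time_holder {f g : ℝ → ℝ} {T a b K₁ K₂ : ℝ} (hT : 0 < T) (ha : 0 < a) (hb : 0 < b)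
    (hab : a + b = 1) (hfc : ContinuousOn f (Icc 0 T)) (hgc : ContinuousOn g (Icc 0 T))
    (hf0 : ∀ t ∈ Icc 0 T, 0 ≤ f t) (hg0 : ∀ t ∈ Icc 0 T, 0 ≤ g t) (hK₁ : 0 ≤ K₁) (hK₂ : 0 ≤ K₂)
    (hf : ∫ t in (0 : ℝ)..T, f t ≤ K₁ * (1 + T)) (hg : ∫ t in (0 : ℝ)..T, g t ≤ K₂ * (1 + T)) :
    ∫ t in (0 : ℝ)..T, f t ^ a * g t ^ b ≤ K₁ ^ a * K₂ ^ b * (1 + T) := by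
  have hH := HsTimeAverages.integral_rpow_mul_rpow_le hT ha hb hab hfc hgc hf0 hg0
  have hfi0 : 0 ≤ ∫ t in (0 : ℝ)..T, f t := intervalIntegral.integral_nonneg hT.le hf0
  have hgi0 : 0 ≤ ∫ t in (0 : ℝ)..T, g t := intervalIntegral.integral_nonneg hT.le hg0
  have h1T : 0 ≤ 1 + T := by linarith
  refine hH.trans ?_
  calc (∫ t in (0 : ℝ)..T, f t) ^ a * (∫ t in (0 : ℝ)..T, g t) ^ b
      ≤ (K₁ * (1 + T)) ^ a * (K₂ * (1 + T)) ^ b :=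
        mul_le_mul (Real.rpow_le_rpow hfi0 hf ha.le) (Real.rpow_le_rpow hgi0 hg hb.le)
          (Real.rpow_nonneg hgi0 _) (Real.rpow_nonneg (mul_nonneg hK₁ h1T) _)
    _ = K₁ ^ a * K₂ ^ b * ((1 + T) ^ a * (1 + T) ^ b) := by
        rw [Real.mul_rpow hK₁ h1T, Real.mul_rpow hK₂ h1T]; ring
    _ = K₁ ^ a * K₂ ^ b * (1 + T) := by
        rw [← Real.rpow_add' h1T (by rw [hab]; exact one_ne_zero), hab, Real.rpow_one]

/-! ## 3. The square `(n, 3)`: `∫₀ᵀ ‖∇ⁿu‖₆^{2/(2n+1)} dt` -/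

/-- **Square `(n, 3)` of Gibbon's chessboard on `T³`, every `n ≥ 0`** (`α_{n,3} = 2/(2n+1)`,
`‖∇ⁿu‖₆^{α_{n,3}} = (∫|∇ⁿu|⁶)^{1/(6n+3)}`): for `ν > 0`, `M ≥ 0` there is `K ≥ 0` with
`∫₀ᵀ (∫ (∑_w ‖∂^w u(t)‖²)³ dx)^{1/(6n+3)} dt ≤ K(1+T)` along every classical zero-mean solution of
unforced Navier–Stokes on `[0, T] × T³` with `‖u(0)‖₂² ≤ M` (Sobolev `∫|∇ⁿv|⁶ ≤ C E_{n+1}³` at every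
order and FGT at `s = n + 1`). [cite: Gibbon2019Chessboard, Thm 1 / Table 1 (square (n, 3)); Appendix A]
[cite: FoiasGuillopeTemam1981, Thm 3.1] (classical solutions, every order; ours) -/
theorem chessboard_three (n : ℕ) {ν M : ℝ} (hν : 0 < ν) (hM : 0 ≤ M) :
    ∃ K : ℝ, 0 ≤ K ∧ ∀ {T : ℝ}, 0 < T →
      ∀ {u : ℝ → UnitAddTorus (Fin 3) → EuclideanSpace ℝ (Fin 3)} {p : ℝ → UnitAddTorus (Fin 3) → ℝ},
      IsClassicalNSSolutionOn (Icc 0 T) ν 0 u p → (∀ t ∈ Icc 0 T, HasZeroMean (u t)) →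
        ∫ x, ‖u 0 x‖ ^ 2 ≤ M →
          ∫ t in (0 : ℝ)..T, (∫ x, (∑ w : Fin n → Fin 3, ‖wordDeriv (List.ofFn w) (u t) x‖ ^ 2) ^ 3) ^
              (6 * (n : ℝ) + 3)⁻¹ ≤ K * (1 + T) := by
  obtain ⟨C, hC0, hC⟩ := HsWordEnergy.exists_integral_cube_sum_norm_sq_wordDeriv_le (d := Fin 3) (by simp) n
  obtain ⟨K, hK0, hK⟩ := HsTimeAverages.timeAverage_le (s := (n : ℝ) + 1)
    (by have : (0 : ℝ) ≤ n := Nat.cast_nonneg n; linarith) hν hM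
  have hn0 : (0 : ℝ) ≤ n := Nat.cast_nonneg n
  have he0 : 0 < (6 * (n : ℝ) + 3)⁻¹ := by positivity
  set e : ℝ := (6 * (n : ℝ) + 3)⁻¹ with he
  refine ⟨C ^ e * K, mul_nonneg (Real.rpow_nonneg hC0 _) hK0, fun {T} hT u p h hmean hu0 => ?_⟩
  set G : ℝ → UnitAddTorus (Fin 3) → ℝ :=
    fun t x => ∑ w : Fin n → Fin 3, ‖wordDeriv (List.ofFn w) (u t) x‖ ^ 2 with hG
  set E : ℝ → ℝ := fun t => torusHsEnergy ((n : ℝ) + 1) (u t) with hE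
  have hE0 : ∀ t ∈ Icc 0 T, 0 ≤ E t := fun t ht =>
    torusHsEnergy_nonneg (by linarith) (h.smooth_velocity.isSmooth_slice ht)
  have hG3 : ∀ t, 0 ≤ ∫ x, G t x ^ 3 := fun t =>
    integral_nonneg fun x => pow_nonneg (Finset.sum_nonneg fun w _ => sq_nonneg _) 3
  -- pointwise in time: `(∫ G³)^e ≤ C^e E_{n+1}^{1/(2n+1)}`
  have hpt : ∀ t ∈ Icc 0 T, (∫ x, G t x ^ 3) ^ e ≤ C ^ e * E t ^ (2 * ((n : ℝ) + 1) - 1)⁻¹ := by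
    intro t ht
    have hut : IsSmooth (u t) := h.smooth_velocity.isSmooth_slice ht
    have h1 : ∫ x, G t x ^ 3 ≤ C * E t ^ 3 := hC (u t) hut (hmean t ht)
    have h2 : (∫ x, G t x ^ 3) ^ e ≤ (C * E t ^ 3) ^ e := Real.rpow_le_rpow (hG3 t) h1 he0.le
    have h3 : (C * E t ^ 3) ^ e = C ^ e * E t ^ (2 * ((n : ℝ) + 1) - 1)⁻¹ := by
      have hne1 : (6 * (n : ℝ) + 3) ≠ 0 := by positivity
      have hne2 : (2 * ((n : ℝ) + 1) - 1) ≠ 0 := by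
        have : (0 : ℝ) < 2 * ((n : ℝ) + 1) - 1 := by linarith
        exact this.ne'
      rw [Real.mul_rpow hC0 (pow_nonneg (hE0 t ht) 3), show (E t ^ 3 : ℝ) = E t ^ (3 : ℝ) by norm_cast,
        ← Real.rpow_mul (hE0 t ht)]
      congr 1; congr 1
      rw [he]; field_simp; ring
    exact h2.trans_eq h3
  -- continuity
  have hIc : ContinuousOn (fun t => (∫ x, G t x ^ 3) ^ e) (Icc 0 T) := by
    have h3c := continuousOn_integral_wordSq_rpow hT h n (by norm_num : (0 : ℝ) ≤ 3)
    have e3 : ∀ t, ∫ x, G t x ^ 3 = ∫ x, (∑ w : Fin n → Fin 3, ‖wordDeriv (List.ofFn w) (u t) x‖ ^ 2) ^ (3 : ℝ) :=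
      fun t => integral_congr_ae (ae_of_all _ fun x => by rw [hG]; norm_cast)
    simp_rw [e3]
    exact h3c.rpow_const fun t _ => Or.inr he0.le
  have hEc : ContinuousOn (fun t => C ^ e * E t ^ (2 * ((n : ℝ) + 1) - 1)⁻¹) (Icc 0 T) :=
    continuousOn_const.mul ((HsTimeAverages.continuousOn_hsEnergy (by linarith) hT h).rpow_const
      fun t _ => Or.inr (inv_nonneg.2 (by linarith)))
  have hmono : ∫ t in (0 : ℝ)..T, (∫ x, G t x ^ 3) ^ e ≤
      ∫ t in (0 : ℝ)..T, C ^ e * E t ^ (2 * ((n : ℝ) + 1) - 1)⁻¹ :=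
    intervalIntegral.integral_mono_on hT.le (hIc.mono (by rw [uIcc_of_le hT.le])).intervalIntegrable
      (hEc.mono (by rw [uIcc_of_le hT.le])).intervalIntegrable fun t ht => hpt t ht
  rw [intervalIntegral.integral_const_mul] at hmono
  have hA := hK hT h hmean hu0
  calc ∫ t in (0 : ℝ)..T, (∫ x, G t x ^ 3) ^ e ≤ C ^ e * ∫ t in (0 : ℝ)..T, E t ^ (2 * ((n : ℝ) + 1) - 1)⁻¹ :=
        hmono
    _ ≤ C ^ e * (K * (1 + T)) := mul_le_mul_of_nonneg_left hA (Real.rpow_nonneg hC0 _)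
    _ = C ^ e * K * (1 + T) := by ring

/-! ## 4. The squares `(n, m)`, `1 < m < 3` -/

/-- **`L²–L⁶` interpolation at every order, `1 < m < 3`** (cf. Gibbon App. A §5.1, there by
Gagliardo–Nirenberg with an auxiliary order `N`; here by `L²–L⁶`): for a smooth zero-mean `v` on `T³`
with the Sobolev
bound `∫ |∇ⁿv|⁶ ≤ C E_{n+1}(v)³` (`HsWordEnergy.exists_integral_cube_sum_norm_sq_wordDeriv_le`),
`∫ |∇ⁿv|^{2m} ≤ C^{(m−1)/2} E_n(v)^{(3−m)/2} E_{n+1}(v)^{3(m−1)/2}`, `|∇ⁿv|² = ∑_w ‖∂^w v‖²`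
(`L²–L⁶` interpolation, `∫|∇ⁿv|² = E_n(v)`). [cite: Gibbon2019Chessboard, Appendix A §5.1 (cf. eqs. (pr2)–(adef2))]
(every order; ours as bookkeeping) -/
theorem integral_wordSq_rpow_le_low (n : ℕ) {m : ℝ} (hm1 : 1 < m) (hm3 : m < 3)
    {v : UnitAddTorus (Fin 3) → EuclideanSpace ℝ (Fin 3)} (hv : IsSmooth v) {C : ℝ} (hC0 : 0 ≤ C)
    (hC : ∫ x, (∑ w : Fin n → Fin 3, ‖wordDeriv (List.ofFn w) v x‖ ^ 2) ^ 3 ≤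
      C * torusHsEnergy ((n : ℝ) + 1) v ^ 3) :
    ∫ x, (∑ w : Fin n → Fin 3, ‖wordDeriv (List.ofFn w) v x‖ ^ 2) ^ m ≤
      C ^ ((m - 1) / 2) * torusHsEnergy (n : ℝ) v ^ ((3 - m) / 2) *
        torusHsEnergy ((n : ℝ) + 1) v ^ (3 * (m - 1) / 2) := by
  set f : UnitAddTorus (Fin 3) → ℝ :=
    fun x => Real.sqrt (∑ w : Fin n → Fin 3, ‖wordDeriv (List.ofFn w) v x‖ ^ 2) with hf
  set X : ℝ := torusHsEnergy (n : ℝ) v with hX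
  set Y : ℝ := torusHsEnergy ((n : ℝ) + 1) v with hY
  have hn0 : (0 : ℝ) ≤ n := Nat.cast_nonneg n
  have hX0 : 0 ≤ X := torusHsEnergy_nonneg hn0 hv
  have hY0 : 0 ≤ Y := torusHsEnergy_nonneg (by linarith) hv
  have hwc : ∀ w : Fin n → Fin 3, Continuous fun x => wordDeriv (List.ofFn w) v x :=
    fun w => (isSmooth_wordDeriv hv _).continuous
  have hfc : Continuous f :=
    Real.continuous_sqrt.comp (continuous_finsetSum _ fun w _ => ((hwc w).norm).pow 2)
  have hf0 : ∀ x, 0 ≤ f x := fun x => Real.sqrt_nonneg _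
  have hf2 : ∀ x, f x ^ 2 = ∑ w : Fin n → Fin 3, ‖wordDeriv (List.ofFn w) v x‖ ^ 2 := fun x =>
    Real.sq_sqrt (Finset.sum_nonneg fun w _ => sq_nonneg _)
  -- `∫ f² = E_n`
  have hfX : ∫ x, f x ^ 2 = X := by
    simp only [hf2]
    rw [integral_finsetSum Finset.univ (f := fun w x => ‖wordDeriv (List.ofFn w) v x‖ ^ 2)
      fun w _ => (((hwc w).norm).pow 2).integrable_unitAddTorus]
    have := HsWordEnergy.wordEnergy_eq_torusHsEnergy n hv
    rw [Torus.wordEnergy] at this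
    rw [hX, ← this]
  have hf6 : ∫ x, f x ^ 6 ≤ C * Y ^ 3 := by
    have e : ∀ x, f x ^ 6 = (∑ w : Fin n → Fin 3, ‖wordDeriv (List.ofFn w) v x‖ ^ 2) ^ 3 := fun x => by
      rw [← hf2]; ring
    simp only [e]; exact hC
  have hI6 : 0 ≤ ∫ x, f x ^ 6 := integral_nonneg fun x => pow_nonneg (hf0 x) 6
  have hfm : ∀ x, f x ^ (2 * m) = (∑ w : Fin n → Fin 3, ‖wordDeriv (List.ofFn w) v x‖ ^ 2) ^ m :=
    fun x => by rw [Real.rpow_mul (hf0 x), Real.rpow_two, hf2]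
  have hq2 : 2 < 2 * m := by linarith
  have hq6 : 2 * m < 6 := by linarith
  have hI := Torus.integral_rpow_le_interpolate_two_six' hq2 hq6 hfc hf0
  simp only [hfm] at hI
  rw [hfX] at hI
  have x1 : (6 - 2 * m) / 4 = (3 - m) / 2 := by ring
  have x2 : (2 * m - 2) / 4 = (m - 1) / 2 := by ring
  rw [x1, x2] at hI
  refine hI.trans ?_
  have h1 : (∫ x, f x ^ 6) ^ ((m - 1) / 2) ≤ (C * Y ^ 3) ^ ((m - 1) / 2) :=
    Real.rpow_le_rpow hI6 hf6 (by linarith)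
  have h2 : (C * Y ^ 3) ^ ((m - 1) / 2) = C ^ ((m - 1) / 2) * Y ^ (3 * (m - 1) / 2) := by
    rw [Real.mul_rpow hC0 (by positivity), show (Y ^ 3 : ℝ) = Y ^ (3 : ℝ) by norm_cast, ← Real.rpow_mul hY0]
    congr 1; congr 1; ring
  calc X ^ ((3 - m) / 2) * (∫ x, f x ^ 6) ^ ((m - 1) / 2)
      ≤ X ^ ((3 - m) / 2) * (C * Y ^ 3) ^ ((m - 1) / 2) :=
        mul_le_mul_of_nonneg_left h1 (Real.rpow_nonneg hX0 _)
    _ = C ^ ((m - 1) / 2) * X ^ ((3 - m) / 2) * Y ^ (3 * (m - 1) / 2) := by rw [h2]; ring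

/-- **Squares `(n, m)`, `1 < m < 3`, of Gibbon's chessboard on `T³`, every `n ≥ 1`**
(`α_{n,m} = 2m/(2m(n+1)−3)`, `‖∇ⁿu‖_{2m}^{α_{n,m}} = (∫|∇ⁿu|^{2m})^{1/(2m(n+1)−3)}`): for `ν > 0`,
`M ≥ 0` there is `K ≥ 0` with `∫₀ᵀ (∫ (∑_w ‖∂^w u(t)‖²)^m dx)^{1/(2m(n+1)−3)} dt ≤ K(1+T)` along every
classical zero-mean solution of unforced Navier–Stokes on `[0, T] × T³` with `‖u(0)‖₂² ≤ M`
(the `L²–L⁶` interpolation above at order `n` — cf. Gibbon App. A §5.1 (GN) — then Hölder in time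
with weights `a = (3−m)(2n−1)/(2(2m(n+1)−3))` on
`E_n^{1/(2n−1)}` and `b = 3(m−1)(2n+1)/(2(2m(n+1)−3))` on `E_{n+1}^{1/(2n+1)}`, `a + b = 1`, against FGT
at `s = n, n + 1`). [cite: Gibbon2019Chessboard, Thm 2 (i) (n ≥ 1, 1 < m < 3), Appendix A §5.1]
[cite: FoiasGuillopeTemam1981, Thm 3.1] (classical solutions, every order; ours) -/
theorem chessboard_low {n : ℕ} (hn : 1 ≤ n) {m : ℝ} (hm1 : 1 < m) (hm3 : m < 3) {ν M : ℝ}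
    (hν : 0 < ν) (hM : 0 ≤ M) :
    ∃ K : ℝ, 0 ≤ K ∧ ∀ {T : ℝ}, 0 < T →
      ∀ {u : ℝ → UnitAddTorus (Fin 3) → EuclideanSpace ℝ (Fin 3)} {p : ℝ → UnitAddTorus (Fin 3) → ℝ},
      IsClassicalNSSolutionOn (Icc 0 T) ν 0 u p → (∀ t ∈ Icc 0 T, HasZeroMean (u t)) →
        ∫ x, ‖u 0 x‖ ^ 2 ≤ M →
          ∫ t in (0 : ℝ)..T, (∫ x, (∑ w : Fin n → Fin 3, ‖wordDeriv (List.ofFn w) (u t) x‖ ^ 2) ^ m) ^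
              (2 * m * ((n : ℝ) + 1) - 3)⁻¹ ≤ K * (1 + T) := by
  have hn1 : (1 : ℝ) ≤ n := by exact_mod_cast hn
  obtain ⟨C, hC0, hC⟩ := HsWordEnergy.exists_integral_cube_sum_norm_sq_wordDeriv_le (d := Fin 3) (by simp) n
  obtain ⟨K₁, hK₁0, hK₁⟩ := HsTimeAverages.timeAverage_le (s := (n : ℝ)) hn1 hν hM
  obtain ⟨K₂, hK₂0, hK₂⟩ := HsTimeAverages.timeAverage_le (s := (n : ℝ) + 1) (by linarith) hν hM
  have hD : 0 < 2 * m * ((n : ℝ) + 1) - 3 := by nlinarith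
  set e : ℝ := (2 * m * ((n : ℝ) + 1) - 3)⁻¹ with he
  have he0 : 0 < e := by rw [he]; positivity
  set a : ℝ := e * ((3 - m) / 2) * (2 * (n : ℝ) - 1) with ha
  set b : ℝ := e * (3 * (m - 1) / 2) * (2 * (n : ℝ) + 1) with hb
  have ha0 : 0 < a := by rw [ha]; exact mul_pos (mul_pos he0 (by linarith)) (by linarith)
  have hb0 : 0 < b := by rw [hb]; exact mul_pos (mul_pos he0 (by linarith)) (by linarith)
  have hab : a + b = 1 := by
    rw [ha, hb, he]; field_simp; ring
  refine ⟨C ^ (e * ((m - 1) / 2)) * (K₁ ^ a * K₂ ^ b),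
    mul_nonneg (Real.rpow_nonneg hC0 _) (mul_nonneg (Real.rpow_nonneg hK₁0 _) (Real.rpow_nonneg hK₂0 _)),
    fun {T} hT u p h hmean hu0 => ?_⟩
  set G : ℝ → UnitAddTorus (Fin 3) → ℝ :=
    fun t x => ∑ w : Fin n → Fin 3, ‖wordDeriv (List.ofFn w) (u t) x‖ ^ 2 with hG
  set X : ℝ → ℝ := fun t => torusHsEnergy (n : ℝ) (u t) with hX
  set Y : ℝ → ℝ := fun t => torusHsEnergy ((n : ℝ) + 1) (u t) with hY
  have hX0 : ∀ t ∈ Icc 0 T, 0 ≤ X t := fun t ht =>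
    torusHsEnergy_nonneg (by linarith) (h.smooth_velocity.isSmooth_slice ht)
  have hY0 : ∀ t ∈ Icc 0 T, 0 ≤ Y t := fun t ht =>
    torusHsEnergy_nonneg (by linarith) (h.smooth_velocity.isSmooth_slice ht)
  have hGm0 : ∀ t, 0 ≤ ∫ x, G t x ^ m := fun t =>
    integral_nonneg fun x => Real.rpow_nonneg (Finset.sum_nonneg fun w _ => sq_nonneg _) _
  -- the two time factors
  set F₁ : ℝ → ℝ := fun t => X t ^ (2 * (n : ℝ) - 1)⁻¹ with hF₁
  set F₂ : ℝ → ℝ := fun t => Y t ^ (2 * ((n : ℝ) + 1) - 1)⁻¹ with hF₂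
  have hF₁0 : ∀ t ∈ Icc 0 T, 0 ≤ F₁ t := fun t ht => Real.rpow_nonneg (hX0 t ht) _
  have hF₂0 : ∀ t ∈ Icc 0 T, 0 ≤ F₂ t := fun t ht => Real.rpow_nonneg (hY0 t ht) _
  -- pointwise in time
  have hpt : ∀ t ∈ Icc 0 T, (∫ x, G t x ^ m) ^ e ≤ C ^ (e * ((m - 1) / 2)) * (F₁ t ^ a * F₂ t ^ b) := by
    intro t ht
    have hut : IsSmooth (u t) := h.smooth_velocity.isSmooth_slice ht
    have h1 := integral_wordSq_rpow_le_low n hm1 hm3 hut hC0 (hC (u t) hut (hmean t ht))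
    have h2 : (∫ x, G t x ^ m) ^ e ≤ (C ^ ((m - 1) / 2) * X t ^ ((3 - m) / 2) * Y t ^ (3 * (m - 1) / 2)) ^ e :=
      Real.rpow_le_rpow (hGm0 t) h1 he0.le
    refine h2.trans_eq ?_
    have hCm : 0 ≤ C ^ ((m - 1) / 2) := Real.rpow_nonneg hC0 _
    rw [Real.mul_rpow (mul_nonneg hCm (Real.rpow_nonneg (hX0 t ht) _)) (Real.rpow_nonneg (hY0 t ht) _),
      Real.mul_rpow hCm (Real.rpow_nonneg (hX0 t ht) _), ← Real.rpow_mul hC0,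
      ← Real.rpow_mul (hX0 t ht), ← Real.rpow_mul (hY0 t ht), hF₁, hF₂]
    simp only
    rw [← Real.rpow_mul (hX0 t ht), ← Real.rpow_mul (hY0 t ht)]
    have hn2 : (2 * (n : ℝ) - 1) ≠ 0 := by
      have : (0 : ℝ) < 2 * (n : ℝ) - 1 := by linarith
      exact this.ne'
    have hn3 : (2 * ((n : ℝ) + 1) - 1) ≠ 0 := by
      have : (0 : ℝ) < 2 * ((n : ℝ) + 1) - 1 := by linarith
      exact this.ne'
    have e1 : (3 - m) / 2 * e = (2 * (n : ℝ) - 1)⁻¹ * a := by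
      rw [ha, show (2 * (n : ℝ) - 1)⁻¹ * (e * ((3 - m) / 2) * (2 * (n : ℝ) - 1)) =
        e * ((3 - m) / 2) * ((2 * (n : ℝ) - 1)⁻¹ * (2 * (n : ℝ) - 1)) by ring, inv_mul_cancel₀ hn2]
      ring
    have e2 : 3 * (m - 1) / 2 * e = (2 * ((n : ℝ) + 1) - 1)⁻¹ * b := by
      rw [hb, show (2 * ((n : ℝ) + 1) - 1)⁻¹ * (e * (3 * (m - 1) / 2) * (2 * (n : ℝ) + 1)) =
        e * (3 * (m - 1) / 2) * ((2 * ((n : ℝ) + 1) - 1)⁻¹ * (2 * ((n : ℝ) + 1) - 1)) by ring,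
        inv_mul_cancel₀ hn3]
      ring
    rw [show (m - 1) / 2 * e = e * ((m - 1) / 2) by ring, e1, e2]
    ring
  -- continuity
  have hIc : ContinuousOn (fun t => (∫ x, G t x ^ m) ^ e) (Icc 0 T) :=
    (continuousOn_integral_wordSq_rpow hT h n (by linarith : (0 : ℝ) ≤ m)).rpow_const
      fun t _ => Or.inr he0.le
  have hF₁c : ContinuousOn F₁ (Icc 0 T) :=
    (HsTimeAverages.continuousOn_hsEnergy (by linarith) hT h).rpow_const
      fun t _ => Or.inr (inv_nonneg.2 (by linarith))
  have hF₂c : ContinuousOn F₂ (Icc 0 T) :=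
    (HsTimeAverages.continuousOn_hsEnergy (by linarith) hT h).rpow_const
      fun t _ => Or.inr (inv_nonneg.2 (by linarith))
  have hRc : ContinuousOn (fun t => C ^ (e * ((m - 1) / 2)) * (F₁ t ^ a * F₂ t ^ b)) (Icc 0 T) :=
    continuousOn_const.mul ((hF₁c.rpow_const fun t _ => Or.inr ha0.le).mul
      (hF₂c.rpow_const fun t _ => Or.inr hb0.le))
  have hmono : ∫ t in (0 : ℝ)..T, (∫ x, G t x ^ m) ^ e ≤
      ∫ t in (0 : ℝ)..T, C ^ (e * ((m - 1) / 2)) * (F₁ t ^ a * F₂ t ^ b) :=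
    intervalIntegral.integral_mono_on hT.le (hIc.mono (by rw [uIcc_of_le hT.le])).intervalIntegrable
      (hRc.mono (by rw [uIcc_of_le hT.le])).intervalIntegrable fun t ht => hpt t ht
  rw [intervalIntegral.integral_const_mul] at hmono
  have hH := time_holder hT ha0 hb0 hab hF₁c hF₂c hF₁0 hF₂0 hK₁0 hK₂0 (hK₁ hT h hmean hu0)
    (hK₂ hT h hmean hu0)
  calc ∫ t in (0 : ℝ)..T, (∫ x, G t x ^ m) ^ e
      ≤ C ^ (e * ((m - 1) / 2)) * ∫ t in (0 : ℝ)..T, F₁ t ^ a * F₂ t ^ b := hmono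
    _ ≤ C ^ (e * ((m - 1) / 2)) * (K₁ ^ a * K₂ ^ b * (1 + T)) :=
        mul_le_mul_of_nonneg_left hH (Real.rpow_nonneg hC0 _)
    _ = C ^ (e * ((m - 1) / 2)) * (K₁ ^ a * K₂ ^ b) * (1 + T) := by ring

end HsChessboard

end Summit.NavierStokesRegularity.FunctionalMining
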